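import Summits.AnomalousDissipation.AnomalousDissipation.Theorems.SolenoidalFractalHomogenisationLagrangianStepSidebandSlotFrame
import Summits.AnomalousDissipation.AnomalousDissipation.Theorems.SolenoidalFractalHomogenisationLagrangianStepSidebandOwnSlot
import HarnessLib

/-!
# K1L_D `LagrangianRenormalisationStepDesign` (stmt-AnomalousDissipation-27980), registered stub `stub_D1_V0thg` (v28, ruling D28-3 (3)), port-map layer L4:
# the FROZEN-FRAME own-slot reduction — evenness/dissipativity of `blockGenθ` and the own-slot Duhamel formula of a twisted periodic response
# (helper; `--supports stmt-AnomalousDissipation-27980 --as helper`)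

Summits-side helper file of route `SolenoidalFractalHomogenisation` (prover seat `ad-k1l-cellLawV-w1` g9; port map
`Cruxes/LagrangianRenormalisationStepDesign/Lines/onelevel-vtheta-twist-portmap.md` §3 L4, rulings D28-7 / D28-11).  The frozen-frame twin of `…SidebandOwnSlot` §2–§3
(§1, the slot-time lemmas `slotEnvelope_eq_zero_of_mem_slot`, `slotEnvelope_eq_trapezoid_of_mem_slot`, `mem_Ico_period_of_mem_slot`, is flat and REUSED BY NAME).
Everything proved; no definitions, no named facts, no sorry.
* `transversalProjR_neg`, **`blockGenθ_neg`** — `P^θ_{−m} = P^θ_m` (`twistFreq G₀ (−m) = −twistFreq G₀ m`) and `B^θ(−m) = B^θ(m)`;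
* **`real_inner_blockGenθ_le`**, `coercive_neg_blockGenθ`, `norm_exp_blockGenθ_le` — under the frame hypothesis `c|k|² ≤ |G₀ᵀk|²` (`0 ≤ c`) and `m ≠ 0`:
  `⟪B^θ u, u⟫_ℝ ≤ −min(γ₁, 4π² lo' c)‖u‖²`, hence `‖exp(τB^θ)u‖ ≤ e^{−min(γ₁,4π²lo'c)τ}‖u‖` (`τ ≥ 0`);
* `hasDerivAt_responseθ_apply`, `continuousOn_coordL_responseθ`, **`coordL_responseθ_eq_duhamel_self / _neg`** — for any twisted periodic response `N` of slot `j`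
  and `t ∈ [startⱼ, startⱼ + τⱼ]`: `(N t v)_{±mⱼ} = exp((t−startⱼ)B^θ) (N startⱼ v)_{±mⱼ} + ∫_{startⱼ}^t exp((t−s)B^θ)(−2πi envⱼ(s) α^{±}ⱼ • P^θ_{±mⱼ} v) ds`.
At `G₀ = 1` every statement is literally its flat twin (`blockGenθ_one`, `responseθ_one`, `IsPeriodicResponseθ` ↔ `IsPeriodicResponse` by `isPeriodicResponseθ_one_iff`).
NOT a proof of any registered stub, of the crux, or of anomalous dissipation; rung F-D1 infrastructure for the `stub_D1_V0thg` engine (L6 `…SidebandOwnSlotLipschitz` uses it).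
-/

set_option linter.dupNamespace false

noncomputable section

namespace Summit.AnomalousDissipation.AnomalousDissipation.Theorems.SolenoidalFractalHomogenisation.LagrangianStep.Sideband

open Set MeasureTheory Complex NormedSpace intervalIntegral
open scoped InnerProductSpace
open Literature.Analysis Literature.Analysis.FunctionSpaces Literature.Analysis.FunctionSpaces.Torus
open Literature.Analysis.FluidPDE Literature.Analysis.FluidPDE.Torus Literature.Analysis.FluidPDE.LatticeShear
open Summit.AnomalousDissipation.AnomalousDissipation.Theorems.SolenoidalFractalHomogenisation.LagrangianStep.CellChain
  (linkCoeff eq_exp_add_integral_of_hasDerivAt slot_window)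
open Summit.AnomalousDissipation.AnomalousDissipation.Theorems.SolenoidalFractalHomogenisation.PermissibleCarrier
  (start_nonneg start_add_tau_le_period period_pos)

variable {k₀ : ℕ}

/-! ## §1 The twisted block generator: evenness and dissipativity -/

/-- `P_{−q} = P_q` for a real wave vector. [cite: Temam1984, Ch. III §1.1] -/
theorem transversalProjR_neg (q : Fin 3 → ℝ) : transversalProjR (-q) = transversalProjR q := by
  ext z : 1
  have hw : (waveVecRC (-q) : EuclideanSpace ℂ (Fin 3)) = -waveVecRC q := by ext i; simp
  have hr : rdot (-q) z = -rdot q z := by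
    simp only [rdot_apply, Pi.neg_apply, Complex.ofReal_neg, neg_mul, Finset.sum_neg_distrib]
  have hs : (∑ j, (-q) j ^ 2 : ℝ) = ∑ j, q j ^ 2 := Finset.sum_congr rfl fun j _ => by simp
  rw [transversalProjR_apply, transversalProjR_apply, hr, hw, hs, mul_neg, neg_smul, smul_neg, neg_neg]

/-- `B(−m) = B(m)` (the Leray projection and the symbol matrix are even in the wave vector). [cite: Frisch1995Turbulence, §9.6.3 eq. (9.57) p. 233] -/
theorem blockGenθ_neg (𝔸 : Torus.Visc4 (Fin 3)) (G₀ : Matrix (Fin 3) (Fin 3) ℝ) (γ₁ : ℝ) (m : Fin 3 → ℤ) : blockGenθ 𝔸 G₀ γ₁ (-m) = blockGenθ 𝔸 G₀ γ₁ m := by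
  ext u : 1
  simp only [blockGenθ_apply, twistFreq_neg, transversalProjR_neg, symbT_neg_wave]

/-- **Dissipativity of the block generator**: for `NearIso 𝔸 lo' hi'`, `lo' ≥ 0`, `m ≠ 0`: `⟪B u, u⟫_ℝ ≤ −min(γ₁, 4π²lo')·‖u‖²`.
[cite: Frisch1995Turbulence, §9.6.3 eq. (9.57) p. 233] [cite: SandersVerhulstMurdock2007, Lemma 5.2.7 (linear case)] -/
theorem real_inner_blockGenθ_le {𝔸 : Torus.Visc4 (Fin 3)} {lo' hi' : ℝ} (h𝔸 : Torus.NearIso 𝔸 lo' hi') (hlo' : 0 ≤ lo')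
    (G₀ : Matrix (Fin 3) (Fin 3) ℝ) {c : ℝ} (hc0 : 0 ≤ c) (hG : ∀ k : Fin 3 → ℤ, c * freqNormSq k ≤ ∑ a, twistFreq G₀ k a ^ 2) (γ₁ : ℝ)
    {m : Fin 3 → ℤ} (hm : m ≠ 0) (u : EuclideanSpace ℂ (Fin 3)) :
    ⟪blockGenθ 𝔸 G₀ γ₁ m u, u⟫_ℝ ≤ -(min γ₁ (4 * Real.pi ^ 2 * (lo' * c))) * ‖u‖ ^ 2 := by
  have h1 := re_inner_transversalProjR_symbT_ge h𝔸 hlo' G₀ hc0 hG hm u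
  have h2 := re_inner_sub_transversalProjR G₀ m u
  have h3 : ‖transversalProjR (twistFreq G₀ m) u‖ ^ 2 ≤ ‖u‖ ^ 2 := pow_le_pow_left₀ (norm_nonneg _) (norm_transversalProjR_le (twistFreq G₀ m) u) 2
  have hre : ⟪blockGenθ 𝔸 G₀ γ₁ m u, u⟫_ℝ =
      -(4 * Real.pi ^ 2 * (⟪transversalProjR (twistFreq G₀ m) (Torus.symbT (Torus.majorTranspose (Torus.Visc4.conj G₀ 𝔸)) m (transversalProjR (twistFreq G₀ m) u)), u⟫_ℂ).re) -
        γ₁ * (‖u‖ ^ 2 - ‖transversalProjR (twistFreq G₀ m) u‖ ^ 2) := by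
    have hre' : ⟪blockGenθ 𝔸 G₀ γ₁ m u, u⟫_ℝ = (⟪blockGenθ 𝔸 G₀ γ₁ m u, u⟫_ℂ).re := real_inner_eq_re_inner ℂ _ _
    rw [hre', blockGenθ_apply, inner_sub_left, inner_neg_left, inner_smul_left, inner_smul_left, Complex.sub_re,
      Complex.neg_re, Complex.conj_ofReal, Complex.conj_ofReal, Complex.re_ofReal_mul, Complex.re_ofReal_mul, h2]
  rw [hre]
  have hμ1 : min γ₁ (4 * Real.pi ^ 2 * (lo' * c)) ≤ γ₁ := min_le_left _ _
  have hμ2 : min γ₁ (4 * Real.pi ^ 2 * (lo' * c)) ≤ 4 * Real.pi ^ 2 * (lo' * c) := min_le_right _ _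
  have ha : 0 ≤ ‖transversalProjR (twistFreq G₀ m) u‖ ^ 2 := sq_nonneg _
  nlinarith [h1, h3, hμ1, hμ2, ha, sub_nonneg.2 h3, Real.pi_pos, mul_le_mul_of_nonneg_right hμ2 ha,
    mul_le_mul_of_nonneg_right hμ1 (sub_nonneg.2 h3)]

/-- Coercivity of `−B` as a real operator (the hypothesis of `PeriodicAveraging.norm_exp_neg_smul_apply_le`). [cite: SandersVerhulstMurdock2007, Lemma 5.2.7] -/
theorem coercive_neg_blockGenθ {𝔸 : Torus.Visc4 (Fin 3)} {lo' hi' : ℝ} (h𝔸 : Torus.NearIso 𝔸 lo' hi') (hlo' : 0 ≤ lo')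
    (G₀ : Matrix (Fin 3) (Fin 3) ℝ) {c : ℝ} (hc0 : 0 ≤ c) (hG : ∀ k : Fin 3 → ℤ, c * freqNormSq k ≤ ∑ a, twistFreq G₀ k a ^ 2) (γ₁ : ℝ)
    {m : Fin 3 → ℤ} (hm : m ≠ 0) (u : EuclideanSpace ℂ (Fin 3)) :
    min γ₁ (4 * Real.pi ^ 2 * (lo' * c)) * ‖u‖ ^ 2 ≤ ⟪(-((blockGenθ 𝔸 G₀ γ₁ m).restrictScalars ℝ)) u, u⟫_ℝ := by
  have h := real_inner_blockGenθ_le h𝔸 hlo' G₀ hc0 hG γ₁ hm u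
  rw [neg_apply, ContinuousLinearMap.coe_restrictScalars', inner_neg_left]
  linarith

/-- **Contraction of the block semigroup**: `‖exp(τ·B) u‖ ≤ e^{−min(γ₁,4π²lo')τ}·‖u‖` for `τ ≥ 0`. [cite: SandersVerhulstMurdock2007, Lemma 5.2.7] -/
theorem norm_exp_blockGenθ_le {𝔸 : Torus.Visc4 (Fin 3)} {lo' hi' : ℝ} (h𝔸 : Torus.NearIso 𝔸 lo' hi') (hlo' : 0 ≤ lo')
    (G₀ : Matrix (Fin 3) (Fin 3) ℝ) {c : ℝ} (hc0 : 0 ≤ c) (hG : ∀ k : Fin 3 → ℤ, c * freqNormSq k ≤ ∑ a, twistFreq G₀ k a ^ 2) (γ₁ : ℝ)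
    {m : Fin 3 → ℤ} (hm : m ≠ 0) (u : EuclideanSpace ℂ (Fin 3)) {τ : ℝ} (hτ : 0 ≤ τ) :
    ‖exp (τ • (blockGenθ 𝔸 G₀ γ₁ m).restrictScalars ℝ) u‖ ≤ Real.exp (-(min γ₁ (4 * Real.pi ^ 2 * (lo' * c)) * τ)) * ‖u‖ := by
  have h := Literature.Analysis.ODE.PeriodicAveraging.norm_exp_neg_smul_apply_le (-((blockGenθ 𝔸 G₀ γ₁ m).restrictScalars ℝ))
    (coercive_neg_blockGenθ h𝔸 hlo' G₀ hc0 hG γ₁ hm) u hτ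
  rwa [smul_neg, neg_neg] at h

/-! ## §2 The own-slot Duhamel formula of a twisted periodic response -/

/-- The orbit `s ↦ N s v` of a periodic response solves `y' = sourceⱼ(s) v + gen(s) y` on `[0, P)`. [cite: SandersVerhulstMurdock2007, Lemma 5.2.7] -/
theorem hasDerivAt_responseθ_apply (W₁ : LatticeWord k₀) (𝔸 : Torus.Visc4 (Fin 3)) (G₀ : Matrix (Fin 3) (Fin 3) ℝ) (γ₁ : ℝ) (R : ℕ) (j : Fin k₀)
    {N : ℝ → (EuclideanSpace ℂ (Fin 3) →L[ℝ] Space R)} (hN : IsPeriodicResponseθ W₁ 𝔸 G₀ γ₁ R j N) (v : EuclideanSpace ℂ (Fin 3))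
    {s : ℝ} (hs : s ∈ Ico 0 W₁.period) :
    HasDerivAt (fun s => N s v) (sourceθ W₁ G₀ R j s v + ((genθ W₁ 𝔸 G₀ γ₁ R s).restrictScalars ℝ) (N s v)) s := by
  have h := (hN.2.1 s hs).clm_apply (hasDerivAt_const s v)
  refine h.congr_deriv ?_
  simp only [add_apply, ContinuousLinearMap.comp_apply, ContinuousLinearMap.coe_restrictScalars', map_zero, add_zero]

/-- The orbit read on a fibre is continuous on `[0, P]`. [cite: SandersVerhulstMurdock2007, Lemma 5.2.7] -/
theorem continuousOn_coordL_responseθ (W₁ : LatticeWord k₀) (𝔸 : Torus.Visc4 (Fin 3)) (G₀ : Matrix (Fin 3) (Fin 3) ℝ) (γ₁ : ℝ) (R : ℕ) (j : Fin k₀)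
    {N : ℝ → (EuclideanSpace ℂ (Fin 3) →L[ℝ] Space R)} (hN : IsPeriodicResponseθ W₁ 𝔸 G₀ γ₁ R j N) (v : EuclideanSpace ℂ (Fin 3))
    (m : Fin 3 → ℤ) : ContinuousOn (fun s => coordL R m (N s v)) (Icc 0 W₁.period) :=
  (coordL R m).continuous.comp_continuousOn (hN.1.clm_apply continuousOn_const)

/-- **OWN-SLOT DUHAMEL FORMULA at `mⱼ`.**  For any periodic response `N` of slot `j` (fibre `mⱼ` retained) and `t ∈ [startⱼ, startⱼ + τⱼ]`:
`(N t v)_{mⱼ} = exp((t − startⱼ)·B) (N startⱼ v)_{mⱼ} + ∫_{startⱼ}^{t} exp((t − s)·B) (−2πi envⱼ(s) αⱼ • P_{mⱼ} v) ds`, `B = blockGenθ 𝔸 G₀ γ₁ mⱼ` over `ℝ`.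
[cite: Hale1980, Ch. III §1, Theorem 1.1 (variation of constants formula)] [cite: MajdaKramer1999, §2.2.1.3 (cell problem (49))] -/
theorem coordL_responseθ_eq_duhamel_self (W₁ : LatticeWord k₀) (𝔸 : Torus.Visc4 (Fin 3)) (G₀ : Matrix (Fin 3) (Fin 3) ℝ) (γ₁ : ℝ) (R : ℕ) (j : Fin k₀)
    {N : ℝ → (EuclideanSpace ℂ (Fin 3) →L[ℝ] Space R)} (hN : IsPeriodicResponseθ W₁ 𝔸 G₀ γ₁ R j N) (hm : (W₁.phase j).m ∈ box R)
    (v : EuclideanSpace ℂ (Fin 3)) {t : ℝ} (ht : t ∈ Icc (W₁.start j) (W₁.start j + (W₁.phase j).τ)) :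
    coordL R (W₁.phase j).m (N t v) =
      exp ((t - W₁.start j) • (blockGenθ 𝔸 G₀ γ₁ (W₁.phase j).m).restrictScalars ℝ) (coordL R (W₁.phase j).m (N (W₁.start j) v)) +
      ∫ s in W₁.start j..t, exp ((t - s) • (blockGenθ 𝔸 G₀ γ₁ (W₁.phase j).m).restrictScalars ℝ)
        ((-(2 * Real.pi * Complex.I * ((slotEnvelope W₁ j s : ℝ) : ℂ) * slotAmp W₁ j)) • transversalProjR (twistFreq G₀ (W₁.phase j).m) v) := by
  set m := (W₁.phase j).m with hmdef
  set G : EuclideanSpace ℂ (Fin 3) →L[ℝ] EuclideanSpace ℂ (Fin 3) := -((blockGenθ 𝔸 G₀ γ₁ m).restrictScalars ℝ) with hG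
  set x : ℝ → EuclideanSpace ℂ (Fin 3) := fun s => coordL R m (N s v) with hx
  set f : ℝ → EuclideanSpace ℂ (Fin 3) := fun s =>
    (-(2 * Real.pi * Complex.I * ((slotEnvelope W₁ j s : ℝ) : ℂ) * slotAmp W₁ j)) • transversalProjR (twistFreq G₀ m) v with hf
  have hsP := start_add_tau_le_period W₁ j
  have hs0 := start_nonneg W₁ j
  have hxc : ContinuousOn x (Icc (W₁.start j) t) :=
    (continuousOn_coordL_responseθ W₁ 𝔸 G₀ γ₁ R j hN v m).mono (Icc_subset_Icc hs0 (ht.2.trans hsP))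
  have hfc : ContinuousOn f (Icc (W₁.start j) t) := by
    refine Continuous.continuousOn ?_
    exact (((continuous_const.mul (Complex.continuous_ofReal.comp (continuous_slotEnvelope W₁ j))).mul continuous_const).neg.smul
      continuous_const)
  have hxd : ∀ s ∈ Ioo (W₁.start j) t, HasDerivAt x (-(G (x s)) + f s) s := by
    intro s hs
    have hslot : s ∈ Ico (W₁.start j) (W₁.start j + (W₁.phase j).τ) := ⟨hs.1.le, lt_of_lt_of_le hs.2 ht.2⟩
    have hoff : ∀ j', j' ≠ j → slotEnvelope W₁ j' s = 0 := fun j' hj' => slotEnvelope_eq_zero_of_mem_slot W₁ hj' hslot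
    have h1 := hasDerivAt_responseθ_apply W₁ 𝔸 G₀ γ₁ R j hN v (mem_Ico_period_of_mem_slot W₁ j hslot)
    have h2 := hasDerivAt_coordL_of_slot_frame W₁ 𝔸 G₀ γ₁ R j hoff (Or.inl hmdef) h1
    refine h2.congr_deriv ?_
    rw [coordL_sourceθ_self W₁ G₀ j s hm, hG, neg_apply, ContinuousLinearMap.coe_restrictScalars', neg_neg, add_comm]
  have hD := eq_exp_add_integral_of_hasDerivAt G ht.1 hxc hfc hxd
  simp only [hG, smul_neg, neg_neg] at hD
  exact hD

/-- **OWN-SLOT DUHAMEL FORMULA at `−mⱼ`** (conjugate amplitude `ᾱⱼ`; `blockGenθ 𝔸 G₀ γ₁ (−mⱼ) = blockGenθ 𝔸 G₀ γ₁ mⱼ` by `blockGenθ_neg`).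
[cite: Hale1980, Ch. III §1, Theorem 1.1 (variation of constants formula)] [cite: MajdaKramer1999, §2.2.1.3 (cell problem (49))] -/
theorem coordL_responseθ_eq_duhamel_neg (W₁ : LatticeWord k₀) (𝔸 : Torus.Visc4 (Fin 3)) (G₀ : Matrix (Fin 3) (Fin 3) ℝ) (γ₁ : ℝ) (R : ℕ) (j : Fin k₀)
    {N : ℝ → (EuclideanSpace ℂ (Fin 3) →L[ℝ] Space R)} (hN : IsPeriodicResponseθ W₁ 𝔸 G₀ γ₁ R j N) (hm : -(W₁.phase j).m ∈ box R)
    (v : EuclideanSpace ℂ (Fin 3)) {t : ℝ} (ht : t ∈ Icc (W₁.start j) (W₁.start j + (W₁.phase j).τ)) :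
    coordL R (-(W₁.phase j).m) (N t v) =
      exp ((t - W₁.start j) • (blockGenθ 𝔸 G₀ γ₁ (-(W₁.phase j).m)).restrictScalars ℝ) (coordL R (-(W₁.phase j).m) (N (W₁.start j) v)) +
      ∫ s in W₁.start j..t, exp ((t - s) • (blockGenθ 𝔸 G₀ γ₁ (-(W₁.phase j).m)).restrictScalars ℝ)
        ((-(2 * Real.pi * Complex.I * ((slotEnvelope W₁ j s : ℝ) : ℂ) * starRingEnd ℂ (slotAmp W₁ j))) • transversalProjR (twistFreq G₀ (-(W₁.phase j).m)) v) := by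
  set m := -(W₁.phase j).m with hmdef
  set G : EuclideanSpace ℂ (Fin 3) →L[ℝ] EuclideanSpace ℂ (Fin 3) := -((blockGenθ 𝔸 G₀ γ₁ m).restrictScalars ℝ) with hG
  set x : ℝ → EuclideanSpace ℂ (Fin 3) := fun s => coordL R m (N s v) with hx
  set f : ℝ → EuclideanSpace ℂ (Fin 3) := fun s =>
    (-(2 * Real.pi * Complex.I * ((slotEnvelope W₁ j s : ℝ) : ℂ) * starRingEnd ℂ (slotAmp W₁ j))) • transversalProjR (twistFreq G₀ m) v with hf
  have hsP := start_add_tau_le_period W₁ j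
  have hs0 := start_nonneg W₁ j
  have hxc : ContinuousOn x (Icc (W₁.start j) t) :=
    (continuousOn_coordL_responseθ W₁ 𝔸 G₀ γ₁ R j hN v m).mono (Icc_subset_Icc hs0 (ht.2.trans hsP))
  have hfc : ContinuousOn f (Icc (W₁.start j) t) := by
    refine Continuous.continuousOn ?_
    exact (((continuous_const.mul (Complex.continuous_ofReal.comp (continuous_slotEnvelope W₁ j))).mul continuous_const).neg.smul
      continuous_const)
  have hxd : ∀ s ∈ Ioo (W₁.start j) t, HasDerivAt x (-(G (x s)) + f s) s := by
    intro s hs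
    have hslot : s ∈ Ico (W₁.start j) (W₁.start j + (W₁.phase j).τ) := ⟨hs.1.le, lt_of_lt_of_le hs.2 ht.2⟩
    have hoff : ∀ j', j' ≠ j → slotEnvelope W₁ j' s = 0 := fun j' hj' => slotEnvelope_eq_zero_of_mem_slot W₁ hj' hslot
    have h1 := hasDerivAt_responseθ_apply W₁ 𝔸 G₀ γ₁ R j hN v (mem_Ico_period_of_mem_slot W₁ j hslot)
    have h2 := hasDerivAt_coordL_of_slot_frame W₁ 𝔸 G₀ γ₁ R j hoff (Or.inr hmdef) h1
    refine h2.congr_deriv ?_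
    rw [coordL_sourceθ_neg W₁ G₀ j s hm, hG, neg_apply, ContinuousLinearMap.coe_restrictScalars', neg_neg, add_comm]
  have hD := eq_exp_add_integral_of_hasDerivAt G ht.1 hxc hfc hxd
  simp only [hG, smul_neg, neg_neg] at hD
  exact hD

end Summit.AnomalousDissipation.AnomalousDissipation.Theorems.SolenoidalFractalHomogenisation.LagrangianStep.Sideband

end
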